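import Summits.AtomisticToContinuum.Crystallization.Theorems.FrustratedLawDichotomyNoTwistSwap
import Summits.AtomisticToContinuum.Crystallization.Theorems.FrustratedLawDichotomyFiniteCertsTol
import Summits.AtomisticToContinuum.Crystallization.Theorems.FrustratedLawDichotomyTwoShellRigidityCoarse

/-!
# FrustratedLawDichotomy · crux `AperiodicFrustratedLawGap` (stmt-AtomisticToContinuum-27623) — `P = CapForcing θ` FROM FIVE FINITE
# CERTIFICATES, `KR2Shape` FROM EIGHT: either mixed «no twist» certificate is redundant (decomp-a2c, prover hand 2, gen 10)

`capForcing_of_certs` (p822220) used the four two-link certificates `NoTwistCert θ P P'` (`P, P' ∈ {fcc, hcp}`) and the two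
`CapMatchCert θ P`.  By the «no-twist swap» (`FrustratedLawDichotomyNoTwistSwap`: the certificate of the swapped pair, applied at the
neighbour, gives the same configuration statement) the two MIXED certificates imply each other's use: one of them can be dropped.

* `capForcingAt_of_halfCap` — `capForcingAt_of_certs` with the half-cap construction abstracted into a hypothesis (same proof);
* `halfCaps_hcp_of_certs` : `NoTwistCert θ fcc hcp ∧ NoTwistCert θ hcp hcp ⟹` half-caps at every corner of an hcp-classified centre;
  `halfCaps_fcc_of_certs` : `NoTwistCert θ fcc fcc ∧ NoTwistCert θ hcp fcc ⟹` the same at an fcc-classified centre;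
* ★ `capForcing_of_fiveCerts` : `NT(fcc,fcc) ∧ NT(fcc,hcp) ∧ NT(hcp,hcp) ∧ CM(fcc) ∧ CM(hcp) ⟹ CapForcing θ` (drops `NT(hcp,fcc)`);
  `capForcing_of_fiveCerts'` : the variant dropping `NT(fcc,hcp)` instead;
* ★ `kr2Shape_of_eightCerts`, `kr2Tol_of_eightCerts`; by name `aperiodicFrustratedLawGap_of_eightCerts` (crux, given `MuEquilibriumDoor ∧
  ChargedEnergyGap`), `noFrustratedPeriodicMinimiser_of_eightCerts` (item 26654, door-free), the tolerance-door version
  `aperiodicFrustratedLawGap_of_price_of_eightCerts_tol`, and — with hand 1's `R` (p822606) — `aperiodicFrustratedLawGap_of_sixCerts_of_basinCertificate`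
  (`LinkCert ∧` five P-certificates `∧ BasinCertificate 4796 (1/100) (1/20)`) and the certificate-free-in-M dial `aperiodicFrustratedLawGap_dial_of_sixCerts`.
The geometric side of the FLD column is now EIGHT finite certificate statements (G ×1, P ×5, M ×2).  `[folklore]` bookkeeping; def-free;
no `sorry`; no `instance`/`notation`.
-/

noncomputable section

namespace Summit.AtomisticToContinuum.Crystallization.Theorems.FrustratedLawDichotomyEightCerts

open Literature.Geometry.DiscreteGeometry
open Summit.AtomisticToContinuum.Crystallization.Theses.PricedLinkCensus (ChargedEnergyGap)
open Summit.AtomisticToContinuum.Crystallization.Theorems.FrustratedLawDichotomyTwoShellRigidityCut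
  (E3 LinkIso Capped CapForcingAt CapForcing LinkClassification KR2Shape kr2Shape_of_cut aperiodicFrustratedLawGap_of_cut
    noFrustratedPeriodicMinimiser_of_cut)
open Summit.AtomisticToContinuum.Crystallization.Theorems.FrustratedLawDichotomyTwoShellRigidityCells (KR2Tol PriceTol BasinCertificate kr2Tol_of_cut)
open Summit.AtomisticToContinuum.Crystallization.Theorems.FrustratedLawDichotomyTwoShellRigidityCoarse
  (aperiodicFrustratedLawGap_of_basinCertificate noFrustratedPeriodicMinimiser_of_basinCertificate aperiodicFrustratedLawGap_dial
    noFrustratedPeriodicMinimiser_dial)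
open Summit.AtomisticToContinuum.Crystallization.Theorems.FrustratedLawDichotomyCappedRigidityCert (CappedCert)
open Summit.AtomisticToContinuum.Crystallization.Theorems.FrustratedLawDichotomyCappedRigidityCertPatterns
  (cappedRigidity_of_cert fcc_contactSeparating hcp_contactSeparating)
open Summit.AtomisticToContinuum.Crystallization.Theorems.FrustratedLawDichotomyLinkCert (LinkCert linkClassification_of_linkCert)
open Summit.AtomisticToContinuum.Crystallization.Theorems.FrustratedLawDichotomyBondGraphWindows
  (one_add_pos_of_adj dist_le_mul_dist_of_adj min_dist_lt_dist_of_not_adj)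
open Summit.AtomisticToContinuum.Crystallization.Theorems.FrustratedLawDichotomyNoTwistCert (BondLike NoTwistCert)
open Summit.AtomisticToContinuum.Crystallization.Theorems.FrustratedLawDichotomyCornerPairingHalfCap (hcp_ncard_common_contacts_of_diagonal)
open Summit.AtomisticToContinuum.Crystallization.Theorems.FrustratedLawDichotomyHalfCap
  (fcc_ncard_common_contacts_of_diagonal exists_halfCap_of_noTwist_fcc exists_halfCap_of_noTwist_hcp)
open Summit.AtomisticToContinuum.Crystallization.Theorems.FrustratedLawDichotomyCapMatchCert
  (CapMatchCert capForcingAt_of_certs)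
open Summit.AtomisticToContinuum.Crystallization.Theorems.FrustratedLawDichotomyTwoShellRigidityCutTol
  (aperiodicFrustratedLawGap_of_price_of_cut_tol)
open Summit.AtomisticToContinuum.Crystallization.Theorems.FrustratedLawDichotomyNoTwistSwap
  (exists_halfCap_hcp_of_noTwist_fcc_hcp exists_halfCap_fcc_of_noTwist_hcp_fcc)

/-! ### §1 `CapForcingAt` with the half-cap construction abstracted -/

/-- **`capForcingAt_of_certs` (p822220) with the half-caps as a hypothesis**: if at every corner `w` of every square `{u, w, v, ·}` of a
`Pat`-classified link (neighbours fcc/hcp-classified) a half-cap `m ∼ τ u, τ v, τ w` (`m ≠ i`, `m ∉ range τ`) exists, then `CapMatchCert θ Pat`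
gives `CapForcingAt θ Pat` (pattern facts: contact separation; diagonal pairs have exactly two common contacts).  Same proof. [folklore] -/
theorem capForcingAt_of_halfCap {θ : ℝ} {Pat : Finset E3}
    (hPat : ∀ u v : ↥Pat, u ≠ v → ∃ c : ↥Pat, dist (u : E3) (c : E3) = 1 ∧ dist (v : E3) (c : E3) ≠ 1)
    (hsq : ∀ a b : ↥Pat, dist (a : E3) (b : E3) = Real.sqrt 2 →
      ({c : ↥Pat | dist (a : E3) (c : E3) = 1} ∩ {c : ↥Pat | dist (b : E3) (c : E3) = 1}).ncard = 2)
    (hCM : CapMatchCert θ Pat)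
    (hHC : ∀ {N : ℕ} {y : Fin N → E3} {i : Fin N} {τ : ↥Pat → Fin N}, Function.Injective y → LinkIso θ Pat y i τ →
      (∀ j : Fin N, (bondGraph θ y).Adj i j →
        (∃ τ' : ↥fccKissingPattern → Fin N, LinkIso θ fccKissingPattern y j τ') ∨
          (∃ τ' : ↥hcpKissingPattern → Fin N, LinkIso θ hcpKissingPattern y j τ')) →
      ∀ (w u v : ↥Pat), dist (w : E3) (u : E3) = 1 → dist (w : E3) (v : E3) = 1 → dist (u : E3) (v : E3) = Real.sqrt 2 →
        ∃ m : Fin N, m ≠ i ∧ (bondGraph θ y).Adj m (τ u) ∧ (bondGraph θ y).Adj m (τ v) ∧ (bondGraph θ y).Adj m (τ w) ∧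
          m ∉ Set.range τ) :
    CapForcingAt θ Pat := by
  classical
  intro N y i τ hy _hsep _hcf _hcf2 hL hnb u v huv
  -- the two common contacts w₁ ≠ w₂ of the diagonal pair {u, v}
  obtain ⟨w₁, w₂, hw12, hS⟩ := Set.ncard_eq_two.1 (hsq u v huv)
  have hw₁ : w₁ ∈ ({c : ↥Pat | dist (u : E3) (c : E3) = 1} ∩ {c : ↥Pat | dist (v : E3) (c : E3) = 1}) := by
    rw [hS]; simp
  have hw₂ : w₂ ∈ ({c : ↥Pat | dist (u : E3) (c : E3) = 1} ∩ {c : ↥Pat | dist (v : E3) (c : E3) = 1}) := by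
    rw [hS]; simp
  obtain ⟨hw₁u, hw₁v⟩ := hw₁
  obtain ⟨hw₂u, hw₂v⟩ := hw₂
  have hw₁u' : dist (w₁ : E3) (u : E3) = 1 := by rw [dist_comm]; exact hw₁u
  have hw₁v' : dist (w₁ : E3) (v : E3) = 1 := by rw [dist_comm]; exact hw₁v
  have hw₂u' : dist (w₂ : E3) (u : E3) = 1 := by rw [dist_comm]; exact hw₂u
  have hw₂v' : dist (w₂ : E3) (v : E3) = 1 := by rw [dist_comm]; exact hw₂v
  -- half-caps from both corners (the hypothesis)
  have halfCap : ∀ w : ↥Pat, dist (w : E3) (u : E3) = 1 → dist (w : E3) (v : E3) = 1 →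
      ∃ m : Fin N, m ≠ i ∧ (bondGraph θ y).Adj m (τ u) ∧ (bondGraph θ y).Adj m (τ v) ∧ (bondGraph θ y).Adj m (τ w) ∧
        m ∉ Set.range τ := fun w hwu hwv => hHC hy hL hnb w u v hwu hwv huv
  obtain ⟨m₁, hm₁i, hm₁u, hm₁v, hm₁w, hm₁r⟩ := halfCap w₁ hw₁u' hw₁v'
  obtain ⟨m₂, hm₂i, hm₂u, hm₂v, hm₂w, hm₂r⟩ := halfCap w₂ hw₂u' hw₂v'
  -- it suffices that the two half-caps coincide
  suffices hmm : m₁ = m₂ by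
    refine ⟨m₁, hm₁i, fun w hw => ?_⟩
    rcases hw with rfl | rfl | ⟨hwu, hwv⟩
    · exact hm₁u
    · exact hm₁v
    · have hmem : w ∈ ({c : ↥Pat | dist (u : E3) (c : E3) = 1} ∩ {c : ↥Pat | dist (v : E3) (c : E3) = 1}) :=
        ⟨by show dist (u : E3) (w : E3) = 1; rw [dist_comm]; exact hwu,
         by show dist (v : E3) (w : E3) = 1; rw [dist_comm]; exact hwv⟩
      rw [hS] at hmem
      simp only [Set.mem_insert_iff, Set.mem_singleton_iff] at hmem
      rcases hmem with rfl | rfl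
      · exact hm₁w
      · rw [hmm]; exact hm₂w
  -- the finite «cap match»: rescale and read off the windows
  have hτ : Function.Injective τ := FrustratedLawDichotomyLinkIsoToolkit.injective_of_linkIso hPat hL
  have hθpos : 0 < 1 + θ := one_add_pos_of_adj hy (hL.1 u)
  have hθ : 0 ≤ 1 + θ := hθpos.le
  set r : ℝ := nearestDist y i with hr_def
  have hui : τ u ≠ i := fun h => (hL.1 u).ne h.symm
  have hr0 : 0 < r := by
    obtain ⟨k₀, hk₀, hr⟩ := exists_nearestDist_eq_dist y (j := i) ⟨τ u, hui⟩
    rw [hr_def, hr]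
    exact dist_pos.2 fun h => hk₀ (hy h).symm
  have hri : 0 < r⁻¹ := inv_pos.2 hr0
  set q : Fin N → E3 := fun j => r⁻¹ • (y j - y i) with hq_def
  have hq_sub : ∀ j l, ‖q j - q l‖ = r⁻¹ * dist (y j) (y l) := by
    intro j l
    simp only [hq_def]
    rw [← smul_sub, sub_sub_sub_cancel_right, norm_smul, Real.norm_of_nonneg hri.le, dist_eq_norm]
  have hqi : q i = 0 := by simp [hq_def]
  have hq_norm : ∀ j, ‖q j‖ = r⁻¹ * dist (y j) (y i) := by
    intro j
    have := hq_sub j i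
    rwa [hqi, sub_zero] at this
  have hq_inj : Function.Injective q := by
    intro j l h
    have h0 : ‖q j - q l‖ = 0 := by rw [h, sub_self, norm_zero]
    rw [hq_sub] at h0
    rcases mul_eq_zero.1 h0 with h1 | h1
    · exact absurd h1 hri.ne'
    · exact hy (dist_eq_zero.1 h1)
  have sA : ∀ j, j ≠ i → 1 ≤ ‖q j‖ := by
    intro j hj
    rw [hq_norm, dist_comm]
    have := nearestDist_le_dist y hj
    rw [← hr_def] at this
    calc (1 : ℝ) = r⁻¹ * r := by field_simp
      _ ≤ r⁻¹ * dist (y i) (y j) := mul_le_mul_of_nonneg_left this hri.le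
  have sR : ∀ j, (bondGraph θ y).Adj i j → ‖q j‖ ≤ 1 + θ := by
    intro j hj
    rw [hq_norm, dist_comm]
    have h1 : dist (y i) (y j) ≤ (1 + θ) * r := dist_le_of_adj hθ hj
    calc r⁻¹ * dist (y i) (y j) ≤ r⁻¹ * ((1 + θ) * r) := mul_le_mul_of_nonneg_left h1 hri.le
      _ = 1 + θ := by field_simp
  have sB : ∀ j k l, (bondGraph θ y).Adj j k → l ≠ j → ‖q j - q k‖ ≤ (1 + θ) * ‖q j - q l‖ := by
    intro j k l hjk hlj
    rw [hq_sub, hq_sub]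
    calc r⁻¹ * dist (y j) (y k) ≤ r⁻¹ * ((1 + θ) * dist (y j) (y l)) :=
          mul_le_mul_of_nonneg_left (dist_le_mul_dist_of_adj hθ hjk hlj) hri.le
      _ = (1 + θ) * (r⁻¹ * dist (y j) (y l)) := by ring
  have sB' : ∀ j k l, (bondGraph θ y).Adj j k → l ≠ k → ‖q j - q k‖ ≤ (1 + θ) * ‖q k - q l‖ := by
    intro j k l hjk hlk
    rw [norm_sub_rev (q j)]
    exact sB k j l hjk.symm hlk
  have sN : ∀ j k j' k', j ≠ k → ¬ (bondGraph θ y).Adj j k → (bondGraph θ y).Adj j j' → (bondGraph θ y).Adj k k' →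
      min ‖q j - q j'‖ ‖q k - q k'‖ < ‖q j - q k‖ := by
    intro j k j' k' hjk hnot hj hk
    rw [hq_sub, hq_sub, hq_sub, ← mul_min_of_nonneg _ _ hri.le]
    exact mul_lt_mul_of_pos_left (min_dist_lt_dist_of_not_adj hθ hjk hnot hj hk) hri
  -- the finite data
  set p : ↥Pat → E3 := fun z => q (τ z) with hp_def
  set K : Set E3 := insert 0 (Set.range p ∪ {q m₁, q m₂}) with hK_def
  have hK : ∀ {Z} {j : Fin N}, Z ∈ K → Z ≠ q j → ∃ l, l ≠ j ∧ q l = Z := by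
    intro Z j hZ hne
    rcases hZ with rfl | hZ
    · exact ⟨i, fun h => hne (by rw [← h, hqi]), hqi⟩
    rcases hZ with ⟨z, rfl⟩ | hZ
    · exact ⟨τ z, fun h => hne (by simp [hp_def, h]), rfl⟩
    · simp only [Set.mem_insert_iff, Set.mem_singleton_iff] at hZ
      rcases hZ with rfl | rfl
      · exact ⟨m₁, fun h => hne (by rw [h]), rfl⟩
      · exact ⟨m₂, fun h => hne (by rw [h]), rfl⟩
  have bondLike : ∀ {j k : Fin N}, (bondGraph θ y).Adj j k → BondLike θ K (q j) (q k) := by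
    intro j k hjk
    refine ⟨fun Z hZ hne => ?_, fun Z hZ hne => ?_⟩
    · obtain ⟨l, hl, rfl⟩ := hK hZ hne
      exact sB j k l hjk hl
    · obtain ⟨l, hl, rfl⟩ := hK hZ hne
      exact sB' j k l hjk hl
  have hτi : ∀ z, τ z ≠ i := fun z h => (hL.1 z).ne h.symm
  have notRange : ∀ {m : Fin N}, m ∉ Set.range τ → q m ∉ Set.range p := by
    intro m hm ⟨z, hz⟩
    exact hm ⟨z, hq_inj (by simpa [hp_def] using hz)⟩
  have notAdj_i : ∀ {m : Fin N}, m ∉ Set.range τ → ¬ (bondGraph θ y).Adj i m := by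
    intro m hm h
    obtain ⟨z, hz⟩ := hL.2.1 _ h
    exact hm ⟨z, hz⟩
  have undet : ∀ (m : Fin N) (z : ↥Pat), m ∉ Set.range τ → (bondGraph θ y).Adj m (τ u) →
      BondLike θ K (q m) (p z) ∨ min ‖q m - p u‖ ‖p z‖ < ‖q m - p z‖ := by
    intro m z hm hmu
    by_cases hadj : (bondGraph θ y).Adj m (τ z)
    · exact Or.inl (bondLike hadj)
    · have hmz : m ≠ τ z := fun h => hm ⟨z, h.symm⟩
      right
      have := sN m (τ z) (τ u) i hmz hadj hmu (hL.1 z).symm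
      simpa [hqi, hp_def] using this
  have hqq : q m₁ = q m₂ := hCM p u v w₁ w₂ (q m₁) (q m₂) huv hw₁u hw₁v hw₂u hw₂v hw12
    (fun z => ⟨sA _ (hτi z), sR _ (hL.1 z)⟩) (hq_inj.comp hτ)
    (fun z => by have := bondLike (hL.1 z); rwa [hqi] at this)
    (fun z z' hzz => bondLike ((hL.2.2 z z').2 hzz))
    (fun z z' hzz hd => by
      have hnot : ¬ (bondGraph θ y).Adj (τ z) (τ z') := fun h => hd ((hL.2.2 z z').1 h)
      have := sN (τ z) (τ z') i i (hτ.ne hzz) hnot (hL.1 z).symm (hL.1 z').symm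
      simpa [hqi] using this)
    (notRange hm₁r) (notRange hm₂r)
    (by rw [← hqi]; exact fun h => hm₁i (hq_inj h)) (by rw [← hqi]; exact fun h => hm₂i (hq_inj h))
    (bondLike hm₁u) (bondLike hm₁v) (bondLike hm₁w) (bondLike hm₂u) (bondLike hm₂v) (bondLike hm₂w)
    (fun z => by
      have := sN i m₁ (τ z) (τ u) hm₁i.symm (notAdj_i hm₁r) (hL.1 z) hm₁u
      rw [hqi, zero_sub, norm_neg, zero_sub, norm_neg] at this
      simpa [hp_def] using this)
    (fun z => by
      have := sN i m₂ (τ z) (τ u) hm₂i.symm (notAdj_i hm₂r) (hL.1 z) hm₂u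
      rw [hqi, zero_sub, norm_neg, zero_sub, norm_neg] at this
      simpa [hp_def] using this)
    (fun z => undet m₁ z hm₁r hm₁u) (fun z => undet m₂ z hm₂r hm₂u)
    (fun hne => by
      have hne' : m₁ ≠ m₂ := fun h => hne (by rw [h])
      by_cases hadj : (bondGraph θ y).Adj m₁ m₂
      · exact Or.inl (bondLike hadj)
      · right
        have := sN m₁ m₂ (τ u) (τ u) hne' hadj hm₁u hm₂u
        simpa [hp_def] using this)
  exact hq_inj hqq

/-! ### §2 The half-caps at every corner from three «no twist» certificates -/

/-- **Half-caps at every corner of an hcp-classified centre from `NoTwistCert θ fcc hcp` (fcc-classified corners, via the swap) and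
`NoTwistCert θ hcp hcp` (hcp-classified corners).** [folklore] -/
theorem halfCaps_hcp_of_certs {θ : ℝ} (hNfh : NoTwistCert θ fccKissingPattern hcpKissingPattern)
    (hNhh : NoTwistCert θ hcpKissingPattern hcpKissingPattern) :
    ∀ {N : ℕ} {y : Fin N → E3} {i : Fin N} {τ : ↥hcpKissingPattern → Fin N}, Function.Injective y →
      LinkIso θ hcpKissingPattern y i τ →
      (∀ j : Fin N, (bondGraph θ y).Adj i j →
        (∃ τ' : ↥fccKissingPattern → Fin N, LinkIso θ fccKissingPattern y j τ') ∨
          (∃ τ' : ↥hcpKissingPattern → Fin N, LinkIso θ hcpKissingPattern y j τ')) →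
      ∀ (w u v : ↥hcpKissingPattern), dist (w : E3) (u : E3) = 1 → dist (w : E3) (v : E3) = 1 →
        dist (u : E3) (v : E3) = Real.sqrt 2 →
        ∃ m : Fin N, m ≠ i ∧ (bondGraph θ y).Adj m (τ u) ∧ (bondGraph θ y).Adj m (τ v) ∧ (bondGraph θ y).Adj m (τ w) ∧
          m ∉ Set.range τ := by
  intro N y i τ hy hL hnb w u v hwu hwv huv
  rcases hnb (τ w) (hL.1 w) with ⟨τ', hL'⟩ | ⟨τ', hL'⟩
  · obtain ⟨w', hw'⟩ := hL'.2.1 i (hL.1 w).symm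
    exact exists_halfCap_hcp_of_noTwist_fcc_hcp hNfh hy hL w hL' hw' hwu hwv huv
  · obtain ⟨w', hw'⟩ := hL'.2.1 i (hL.1 w).symm
    exact exists_halfCap_of_noTwist_hcp hcp_contactSeparating hNhh hy hL w hL' hw' hwu hwv huv

/-- **Half-caps at every corner of an fcc-classified centre from `NoTwistCert θ fcc fcc` (fcc-classified corners) and
`NoTwistCert θ hcp fcc` (hcp-classified corners, via the swap).** [folklore] -/
theorem halfCaps_fcc_of_certs {θ : ℝ} (hNff : NoTwistCert θ fccKissingPattern fccKissingPattern)
    (hNhf : NoTwistCert θ hcpKissingPattern fccKissingPattern) :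
    ∀ {N : ℕ} {y : Fin N → E3} {i : Fin N} {τ : ↥fccKissingPattern → Fin N}, Function.Injective y →
      LinkIso θ fccKissingPattern y i τ →
      (∀ j : Fin N, (bondGraph θ y).Adj i j →
        (∃ τ' : ↥fccKissingPattern → Fin N, LinkIso θ fccKissingPattern y j τ') ∨
          (∃ τ' : ↥hcpKissingPattern → Fin N, LinkIso θ hcpKissingPattern y j τ')) →
      ∀ (w u v : ↥fccKissingPattern), dist (w : E3) (u : E3) = 1 → dist (w : E3) (v : E3) = 1 →
        dist (u : E3) (v : E3) = Real.sqrt 2 →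
        ∃ m : Fin N, m ≠ i ∧ (bondGraph θ y).Adj m (τ u) ∧ (bondGraph θ y).Adj m (τ v) ∧ (bondGraph θ y).Adj m (τ w) ∧
          m ∉ Set.range τ := by
  intro N y i τ hy hL hnb w u v hwu hwv huv
  rcases hnb (τ w) (hL.1 w) with ⟨τ', hL'⟩ | ⟨τ', hL'⟩
  · obtain ⟨w', hw'⟩ := hL'.2.1 i (hL.1 w).symm
    exact exists_halfCap_of_noTwist_fcc fcc_contactSeparating hNff hy hL w hL' hw' hwu hwv huv
  · obtain ⟨w', hw'⟩ := hL'.2.1 i (hL.1 w).symm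
    exact exists_halfCap_fcc_of_noTwist_hcp_fcc hNhf hy hL w hL' hw' hwu hwv huv

/-! ### §3 `P` from five certificates, `KR2Shape` from eight, and the column by name -/

/-- ★ **`CapForcing θ` FROM FIVE FINITE CERTIFICATES**: `NoTwistCert θ fcc fcc`, `NoTwistCert θ fcc hcp`, `NoTwistCert θ hcp hcp`,
`CapMatchCert θ fcc`, `CapMatchCert θ hcp` — the mixed certificate `NoTwistCert θ hcp fcc` of p822220's six is REDUNDANT. [folklore] -/
theorem capForcing_of_fiveCerts {θ : ℝ}
    (hNff : NoTwistCert θ fccKissingPattern fccKissingPattern) (hNfh : NoTwistCert θ fccKissingPattern hcpKissingPattern)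
    (hNhh : NoTwistCert θ hcpKissingPattern hcpKissingPattern)
    (hCf : CapMatchCert θ fccKissingPattern) (hCh : CapMatchCert θ hcpKissingPattern) : CapForcing θ :=
  ⟨capForcingAt_of_certs fcc_contactSeparating fcc_ncard_common_contacts_of_diagonal hNff hNfh hCf,
   capForcingAt_of_halfCap hcp_contactSeparating hcp_ncard_common_contacts_of_diagonal hCh (halfCaps_hcp_of_certs hNfh hNhh)⟩

/-- **The variant dropping the other mixed certificate**: `NoTwistCert θ fcc fcc`, `NoTwistCert θ hcp fcc`, `NoTwistCert θ hcp hcp`,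
`CapMatchCert θ fcc/hcp ⟹ CapForcing θ`. [folklore] -/
theorem capForcing_of_fiveCerts' {θ : ℝ}
    (hNff : NoTwistCert θ fccKissingPattern fccKissingPattern) (hNhf : NoTwistCert θ hcpKissingPattern fccKissingPattern)
    (hNhh : NoTwistCert θ hcpKissingPattern hcpKissingPattern)
    (hCf : CapMatchCert θ fccKissingPattern) (hCh : CapMatchCert θ hcpKissingPattern) : CapForcing θ :=
  ⟨capForcingAt_of_halfCap fcc_contactSeparating fcc_ncard_common_contacts_of_diagonal hCf (halfCaps_fcc_of_certs hNff hNhf),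
   capForcingAt_of_certs hcp_contactSeparating hcp_ncard_common_contacts_of_diagonal hNhf hNhh hCh⟩

/-- ★ **`KR2Shape` FROM EIGHT FINITE CERTIFICATES**: `LinkCert(1/100)` (G); `NoTwistCert(1/100)` for `(fcc,fcc), (fcc,hcp), (hcp,hcp)` and
`CapMatchCert(1/100, fcc/hcp)` (P); `CappedCert(1/100, 1/20, fcc/hcp)` (M). [folklore] -/
theorem kr2Shape_of_eightCerts (hG : LinkCert (1 / 100))
    (hNff : NoTwistCert (1 / 100) fccKissingPattern fccKissingPattern) (hNfh : NoTwistCert (1 / 100) fccKissingPattern hcpKissingPattern)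
    (hNhh : NoTwistCert (1 / 100) hcpKissingPattern hcpKissingPattern)
    (hCf : CapMatchCert (1 / 100) fccKissingPattern) (hCh : CapMatchCert (1 / 100) hcpKissingPattern)
    (hMf : CappedCert (1 / 100) (1 / 20) fccKissingPattern) (hMh : CappedCert (1 / 100) (1 / 20) hcpKissingPattern) : KR2Shape :=
  kr2Shape_of_cut (linkClassification_of_linkCert hG) (capForcing_of_fiveCerts hNff hNfh hNhh hCf hCh) (cappedRigidity_of_cert hMf hMh)

/-- **`KR2Tol θ η` from the eight certificates at `(θ, η)`** (every `θ, η`). [folklore] -/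
theorem kr2Tol_of_eightCerts {θ η : ℝ} (hG : LinkCert θ)
    (hNff : NoTwistCert θ fccKissingPattern fccKissingPattern) (hNfh : NoTwistCert θ fccKissingPattern hcpKissingPattern)
    (hNhh : NoTwistCert θ hcpKissingPattern hcpKissingPattern)
    (hCf : CapMatchCert θ fccKissingPattern) (hCh : CapMatchCert θ hcpKissingPattern)
    (hMf : CappedCert θ η fccKissingPattern) (hMh : CappedCert θ η hcpKissingPattern) : KR2Tol θ η :=
  kr2Tol_of_cut (linkClassification_of_linkCert hG) (capForcing_of_fiveCerts hNff hNfh hNhh hCf hCh) (cappedRigidity_of_cert hMf hMh)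

/-- **`AperiodicFrustratedLawGap` (crux of item 27623) BY NAME from `MuEquilibriumDoor ∧ ChargedEnergyGap` and the EIGHT finite
certificates.** [folklore] -/
theorem aperiodicFrustratedLawGap_of_eightCerts
    (hDoor : Summit.AtomisticToContinuum.Crystallization.Theses.GrainCoreNetworkSplit.MuEquilibriumDoor) (hgap : ChargedEnergyGap)
    (hG : LinkCert (1 / 100))
    (hNff : NoTwistCert (1 / 100) fccKissingPattern fccKissingPattern) (hNfh : NoTwistCert (1 / 100) fccKissingPattern hcpKissingPattern)
    (hNhh : NoTwistCert (1 / 100) hcpKissingPattern hcpKissingPattern)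
    (hCf : CapMatchCert (1 / 100) fccKissingPattern) (hCh : CapMatchCert (1 / 100) hcpKissingPattern)
    (hMf : CappedCert (1 / 100) (1 / 20) fccKissingPattern) (hMh : CappedCert (1 / 100) (1 / 20) hcpKissingPattern) :
    Summit.AtomisticToContinuum.Crystallization.Theses.FrustratedLawDichotomy.AperiodicFrustratedLawGap :=
  aperiodicFrustratedLawGap_of_cut hDoor hgap (linkClassification_of_linkCert hG) (capForcing_of_fiveCerts hNff hNfh hNhh hCf hCh)
    (cappedRigidity_of_cert hMf hMh)

/-- **Item 26654 `NoFrustratedPeriodicMinimiser`, door-free, from `ChargedEnergyGap` and the eight finite certificates.** [folklore] -/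
theorem noFrustratedPeriodicMinimiser_of_eightCerts (hgap : ChargedEnergyGap) (hG : LinkCert (1 / 100))
    (hNff : NoTwistCert (1 / 100) fccKissingPattern fccKissingPattern) (hNfh : NoTwistCert (1 / 100) fccKissingPattern hcpKissingPattern)
    (hNhh : NoTwistCert (1 / 100) hcpKissingPattern hcpKissingPattern)
    (hCf : CapMatchCert (1 / 100) fccKissingPattern) (hCh : CapMatchCert (1 / 100) hcpKissingPattern)
    (hMf : CappedCert (1 / 100) (1 / 20) fccKissingPattern) (hMh : CappedCert (1 / 100) (1 / 20) hcpKissingPattern) :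
    Summit.AtomisticToContinuum.Crystallization.Theses.PeriodicChargeSplit.NoFrustratedPeriodicMinimiser :=
  noFrustratedPeriodicMinimiser_of_cut hgap (linkClassification_of_linkCert hG) (capForcing_of_fiveCerts hNff hNfh hNhh hCf hCh)
    (cappedRigidity_of_cert hMf hMh)

/-- **Through the tolerance door**: `MuEquilibriumDoor ∧ Price(θ)` and the eight certificates at `(θ, η)`, `0 < θ ≤ 1/100`, `η < 1/20`
`⟹ AperiodicFrustratedLawGap`. [folklore] -/
theorem aperiodicFrustratedLawGap_of_price_of_eightCerts_tol {θ η : ℝ} (hθ0 : 0 < θ) (hθ1 : θ ≤ 1 / 100) (hη : η < 1 / 20)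
    (hDoor : Summit.AtomisticToContinuum.Crystallization.Theses.GrainCoreNetworkSplit.MuEquilibriumDoor) (hprice : PriceTol θ)
    (hG : LinkCert θ)
    (hNff : NoTwistCert θ fccKissingPattern fccKissingPattern) (hNfh : NoTwistCert θ fccKissingPattern hcpKissingPattern)
    (hNhh : NoTwistCert θ hcpKissingPattern hcpKissingPattern)
    (hCf : CapMatchCert θ fccKissingPattern) (hCh : CapMatchCert θ hcpKissingPattern)
    (hMf : CappedCert θ η fccKissingPattern) (hMh : CappedCert θ η hcpKissingPattern) :
    Summit.AtomisticToContinuum.Crystallization.Theses.FrustratedLawDichotomy.AperiodicFrustratedLawGap :=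
  aperiodicFrustratedLawGap_of_price_of_cut_tol hθ0 hθ1 hη hDoor hprice (linkClassification_of_linkCert hG)
    (capForcing_of_fiveCerts hNff hNfh hNhh hCf hCh) (cappedRigidity_of_cert hMf hMh)

/-- **With hand 1's `R` (p822606)**: `MuEquilibriumDoor ∧ ChargedEnergyGap ∧ LinkCert(1/100) ∧` the five P-certificates `∧
BasinCertificate 4796 (1/100) (1/20) ⟹ AperiodicFrustratedLawGap` — SIX finite certificates and one basin certificate. [folklore] -/
theorem aperiodicFrustratedLawGap_of_sixCerts_of_basinCertificate
    (hDoor : Summit.AtomisticToContinuum.Crystallization.Theses.GrainCoreNetworkSplit.MuEquilibriumDoor) (hgap : ChargedEnergyGap)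
    (hG : LinkCert (1 / 100))
    (hNff : NoTwistCert (1 / 100) fccKissingPattern fccKissingPattern) (hNfh : NoTwistCert (1 / 100) fccKissingPattern hcpKissingPattern)
    (hNhh : NoTwistCert (1 / 100) hcpKissingPattern hcpKissingPattern)
    (hCf : CapMatchCert (1 / 100) fccKissingPattern) (hCh : CapMatchCert (1 / 100) hcpKissingPattern)
    (hL : BasinCertificate 4796 (1 / 100) (1 / 20)) :
    Summit.AtomisticToContinuum.Crystallization.Theses.FrustratedLawDichotomy.AperiodicFrustratedLawGap :=
  aperiodicFrustratedLawGap_of_basinCertificate hDoor hgap (linkClassification_of_linkCert hG)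
    (capForcing_of_fiveCerts hNff hNfh hNhh hCf hCh) hL

/-- **Item 26654 sibling**: `ChargedEnergyGap ∧ LinkCert(1/100) ∧` five P-certificates `∧ BasinCertificate 4796 (1/100) (1/20) ⟹
NoFrustratedPeriodicMinimiser`. [folklore] -/
theorem noFrustratedPeriodicMinimiser_of_sixCerts_of_basinCertificate (hgap : ChargedEnergyGap) (hG : LinkCert (1 / 100))
    (hNff : NoTwistCert (1 / 100) fccKissingPattern fccKissingPattern) (hNfh : NoTwistCert (1 / 100) fccKissingPattern hcpKissingPattern)
    (hNhh : NoTwistCert (1 / 100) hcpKissingPattern hcpKissingPattern)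
    (hCf : CapMatchCert (1 / 100) fccKissingPattern) (hCh : CapMatchCert (1 / 100) hcpKissingPattern)
    (hL : BasinCertificate 4796 (1 / 100) (1 / 20)) :
    Summit.AtomisticToContinuum.Crystallization.Theses.PeriodicChargeSplit.NoFrustratedPeriodicMinimiser :=
  noFrustratedPeriodicMinimiser_of_basinCertificate hgap (linkClassification_of_linkCert hG)
    (capForcing_of_fiveCerts hNff hNfh hNhh hCf hCh) hL

/-- **The dial, certificate-free in M**: for `0 < θ < 1/95920`, `MuEquilibriumDoor ∧ PriceTol θ ∧ LinkCert θ ∧` the five P-certificates at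
`θ` `⟹ AperiodicFrustratedLawGap`. [folklore] -/
theorem aperiodicFrustratedLawGap_dial_of_sixCerts {θ : ℝ} (hθ0 : 0 < θ) (hθ : θ < 1 / 95920)
    (hDoor : Summit.AtomisticToContinuum.Crystallization.Theses.GrainCoreNetworkSplit.MuEquilibriumDoor) (hprice : PriceTol θ)
    (hG : LinkCert θ)
    (hNff : NoTwistCert θ fccKissingPattern fccKissingPattern) (hNfh : NoTwistCert θ fccKissingPattern hcpKissingPattern)
    (hNhh : NoTwistCert θ hcpKissingPattern hcpKissingPattern)
    (hCf : CapMatchCert θ fccKissingPattern) (hCh : CapMatchCert θ hcpKissingPattern) :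
    Summit.AtomisticToContinuum.Crystallization.Theses.FrustratedLawDichotomy.AperiodicFrustratedLawGap :=
  aperiodicFrustratedLawGap_dial hθ0 hθ hDoor hprice (linkClassification_of_linkCert hG) (capForcing_of_fiveCerts hNff hNfh hNhh hCf hCh)

/-- **The dial, door-free sibling (item 26654)**: for `0 < θ < 1/95920`, `PriceTol θ ∧ LinkCert θ ∧` five P-certificates `⟹
NoFrustratedPeriodicMinimiser`. [folklore] -/
theorem noFrustratedPeriodicMinimiser_dial_of_sixCerts {θ : ℝ} (hθ0 : 0 < θ) (hθ : θ < 1 / 95920) (hprice : PriceTol θ)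
    (hG : LinkCert θ)
    (hNff : NoTwistCert θ fccKissingPattern fccKissingPattern) (hNfh : NoTwistCert θ fccKissingPattern hcpKissingPattern)
    (hNhh : NoTwistCert θ hcpKissingPattern hcpKissingPattern)
    (hCf : CapMatchCert θ fccKissingPattern) (hCh : CapMatchCert θ hcpKissingPattern) :
    Summit.AtomisticToContinuum.Crystallization.Theses.PeriodicChargeSplit.NoFrustratedPeriodicMinimiser :=
  noFrustratedPeriodicMinimiser_dial hθ0 hθ hprice (linkClassification_of_linkCert hG) (capForcing_of_fiveCerts hNff hNfh hNhh hCf hCh)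

end Summit.AtomisticToContinuum.Crystallization.Theorems.FrustratedLawDichotomyEightCerts

end
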